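import Summits.BirchSwinnertonDyer.Rank1Residual.JET.CarrierReadingRecordsKitFed
import Summits.BirchSwinnertonDyer.BirchSwinnertonDyer.Theorems.Rank1ResidualJetCarrierNeKitThree
import Summits.BirchSwinnertonDyer.BirchSwinnertonDyer.Theorems.Rank1ResidualJetCarrierAdd
import HarnessLib

/-!
# T1 JET (cell `bsd-jet`): FED twins of the reading-conditional CLASS-FREE CONSUMERS at a Heegner level —
# `hrec`, `hD36` supplied by Literature theorems, `hlev` reduced to modularity (sibling of `CarrierReadingRecordsKitFed`)

HONEST FRAMING (programme `BSD-LIT2PART-PROGRAMME-v1.md` §HONESTY, verbatim): «no tranche here proves BSD;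
ARM L moves the LITERAL column of an r ≤ 1 census into the kernel-proved-modulo-named-print column; ARM P
changes what «named print» is worth.» THEOREMS ONLY; nothing is booked by this file; nothing about any particular
curve is asserted. Seat `bsd-jet-ty` (typer), g6. The prover files are not modified.

WHAT THIS FILE IS. The documentary strikes of the `JET@p∣N` road (referee A R409 bucket A, R516/R518 bucket B,
R600 datum addendum) cite, per class, a READING binder (`JET.JetchevDivisibilityCarrierNe` K1 /
`…CarrierMult` K3 / `…CarrierAdd` K4) consumed by the provers' CLASS-FREE consumers at a Heegner level `N`:
`JET.bsdp_of_carrierNeCertificate_level[_of_five_le | _of_mult]` (seat `bsd-jet-pv-1`, `Theorems/Rank1ResidualJetCarrierNeRows`),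
`JET.bsdp_of_carrierNeCertificate_level_of_irr_of_ram` / `…_level_three_of_frobenius` (roads R / F,
`Theorems/Rank1ResidualJetCarrierNeKitThree`), `JET.bsdp_of_carrierMultCertificate_level_of_surj` (seat `bsd-jet-pv-2`,
`Theorems/Rank1ResidualJetCarrierMult`), `JET.bsdp_of_carrierAddCertificate_level[_three_of_frobenius]`
(`Theorems/Rank1ResidualJetCarrierAdd`). Each DISPLAYS, besides `hJ`, `hMcU` (McCallum 1991 Cor. 5.6), `hGZK`, `hKo`,
the three inherited binders `hrec` (Shimura reciprocity for `y(1)`, Darmon 2004 Thm. 3.7 — now the Literature theorem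
`heegnerPointOfConductor_one_galoisConj_holds`), `hD36` (Darmon Thm. 3.6 at conductor `1` — Literature theorem
`phi_heegnerTau_mem_singularModuliField_holds`) and `hlev` (Carayol — `IsNewformOf.level_eq_conductorNorm_of_exists_isNewformOf'`
from the modularity binder). As in the sibling files (record doors, p512568 / p513255; landed rows, p513786) each
consumer gets a FED twin `<consumer>_fed`: the same statement with `hrec`, `hD36` REMOVED and `hlev` REPLACED by
`hmod : exists_isNewformOf`, proved by the consumer with every explicit binder passed by name (feeders from
`CarrierReadingRecordsKitFed` §0). Displayed named print of the road consumers after feeding: {`hJ`, `hMcU`, `hGZK`,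
`hKo`, `hmod`}. PARTITION: row D5 `JET@p∣N` — 0 classes moved by this file.

References: H. Darmon, CBMS 101 (2004) Thm. 3.6 / 3.7 [Darmon2004]; B. H. Gross, LMS LN 153 (1991) §4
[GrossLMS1991]; Diamond–Shurman, GTM 228 (2005) Thm. 8.8.1 [DiamondShurman2005]; D. Jetchev, Compos. Math. 144
(2008) Thm. 1.4, Cor. 1.5 [Jetchev2008]; W. McCallum, in *L-functions and Arithmetic* (1991) Cor. 5.6 [McCallum1991].
-/

set_option autoImplicit false

noncomputable section

open scoped Classical

open IsDedekindDomain NumberField Rat.HeightOneSpectrum WeierstrassCurve Literature.NumberTheory.EllipticCurves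
  Literature.NumberTheory.EllipticCurves.ModularForms
  Literature.NumberTheory.EllipticCurves.Rank1Residual
  Literature.NumberTheory.EllipticCurves.Rank1Residual.Typed
  Literature.NumberTheory.EllipticCurves.Rank1Residual.X11RankOneCertificates
  Summit.BirchSwinnertonDyer.BirchSwinnertonDyer.Rank1Residual
  Summit.BirchSwinnertonDyer.BirchSwinnertonDyer.Rank1Residual.IntModel
  Summit.BirchSwinnertonDyer.BirchSwinnertonDyer.Rank1Residual.X11RankOne
  Summit.BirchSwinnertonDyer.BirchSwinnertonDyer.Rank2Observatory.Tam
  Summit.BirchSwinnertonDyer.Rank1Residual Summit.BirchSwinnertonDyer.Rank1Residual.X11b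

namespace Summit.BirchSwinnertonDyer.Rank1Residual.JET


/-! ## §1 bucket A (carrier `q ≠ p`): the reading-conditional class-free consumers at a Heegner level -/
/-- **FED twin of `JET.bsdp_of_carrierNeCertificate_level`** — bucket A at a Heegner level `N` (pv-1, p462126):
the consumer's statement with `hrec` / `hD36` SUPPLIED by the Literature theorems and `hlev` by `hmod :
exists_isNewformOf`; every other binder verbatim, by name. -/
theorem bsdp_of_carrierNeCertificate_level_fed
    (hJ : JetchevDivisibilityCarrierNe)
    (hMcU : McCallum1991_padicValNat_card_sha_primary_add_le_of_globalDivisibility)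
    (hGZK : rank_eq_analyticRank_of_analyticRank_le_one)
    (hKo : ∀ (N : ℕ) [NeZero N] (W : WeierstrassCurve ℚ) (K : Type) [Field K] [NumberField K],
      kolyvagin N W K)
    (hmod : exists_isNewformOf) (W : WeierstrassCurve ℚ) [W.IsElliptic] [W.IsGloballyMinimal]
    (p : ℕ) [Fact p.Prime] {N : ℕ} [NeZero N] {K : Type} [Field K] [NumberField K]
    (hK : IsImaginaryQuadratic K) (hD3 : NumberField.discr K ≠ -3) (hD4 : NumberField.discr K ≠ -4)
    (hH : SatisfiesHeegnerHypothesis N K) {P : (W.baseChange K).toAffine.Point}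
    (hP : IsHeegnerPoint N W K P) (hnt : ¬ IsOfFinAddOrder P) (hp2 : p ≠ 2)
    (htower : ∀ n : ℕ, W.HasSurjectiveModNGaloisRep (p ^ n : ℕ)) (q : ℕ) [Fact q.Prime]
    (hqN : q ∣ N) (hqp : q ≠ p)
    (hI : padicValNat p (AddSubgroup.zmultiples P).index ≤
      padicValNat p ((W.baseChange ℚ_[q]).localTamagawaNumber ℤ_[q]))
    (hr : W.analyticRank ≤ 1) {s : ℚ} (hs : shaAn W = (s : ℂ)) (hv : padicValRat p s = 0) :
    BSDp W p :=
  bsdp_of_carrierNeCertificate_level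
    (hJ := hJ) (hMcU := hMcU) (hGZK := hGZK) (hKo := hKo)
    (hrec := heegnerPointOfConductor_one_galoisConj_forall)
    (hD36 := (fun N _ W K _ _ => phi_heegnerTau_mem_singularModuliField_holds N W K))
    (hlev := (level_eq_conductorNorm_forall_of_exists_isNewformOf hmod)) (W := W) (p := p)
    (hK := hK) (hD3 := hD3) (hD4 := hD4) (hH := hH) (hP := hP) (hnt := hnt) (hp2 := hp2)
    (htower := htower) (q := q) (hqN := hqN) (hqp := hqp) (hI := hI) (hr := hr) (hs := hs)
    (hv := hv)

/-- **FED twin of `JET.bsdp_of_carrierNeCertificate_level_of_five_le`** — bucket A, `p ≥ 5`, level form — the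
road consumer named in OFFER-JET-DOCSTRIKE-BUCKET-A (pv-1, p462126): the consumer's statement with `hrec` /
`hD36` SUPPLIED by the Literature theorems and `hlev` by `hmod : exists_isNewformOf`; every other binder
verbatim, by name. -/
theorem bsdp_of_carrierNeCertificate_level_of_five_le_fed
    (hJ : JetchevDivisibilityCarrierNe)
    (hMcU : McCallum1991_padicValNat_card_sha_primary_add_le_of_globalDivisibility)
    (hGZK : rank_eq_analyticRank_of_analyticRank_le_one)
    (hKo : ∀ (N : ℕ) [NeZero N] (W : WeierstrassCurve ℚ) (K : Type) [Field K] [NumberField K],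
      kolyvagin N W K)
    (hmod : exists_isNewformOf) (W : WeierstrassCurve ℚ) [W.IsElliptic] [W.IsGloballyMinimal]
    (p : ℕ) [Fact p.Prime] {N : ℕ} [NeZero N] {K : Type} [Field K] [NumberField K]
    (hK : IsImaginaryQuadratic K) (hD3 : NumberField.discr K ≠ -3) (hD4 : NumberField.discr K ≠ -4)
    (hH : SatisfiesHeegnerHypothesis N K) {P : (W.baseChange K).toAffine.Point}
    (hP : IsHeegnerPoint N W K P) (hnt : ¬ IsOfFinAddOrder P) (h5 : 5 ≤ p)
    (hsurj : W.HasSurjectiveModNGaloisRep p) (q : ℕ) [Fact q.Prime] (hqN : q ∣ N) (hqp : q ≠ p)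
    (hI : padicValNat p (AddSubgroup.zmultiples P).index ≤
      padicValNat p ((W.baseChange ℚ_[q]).localTamagawaNumber ℤ_[q]))
    (hr : W.analyticRank ≤ 1) {s : ℚ} (hs : shaAn W = (s : ℂ)) (hv : padicValRat p s = 0) :
    BSDp W p :=
  bsdp_of_carrierNeCertificate_level_of_five_le
    (hJ := hJ) (hMcU := hMcU) (hGZK := hGZK) (hKo := hKo)
    (hrec := heegnerPointOfConductor_one_galoisConj_forall)
    (hD36 := (fun N _ W K _ _ => phi_heegnerTau_mem_singularModuliField_holds N W K))
    (hlev := (level_eq_conductorNorm_forall_of_exists_isNewformOf hmod)) (W := W) (p := p)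
    (hK := hK) (hD3 := hD3) (hD4 := hD4) (hH := hH) (hP := hP) (hnt := hnt) (h5 := h5)
    (hsurj := hsurj) (q := q) (hqN := hqN) (hqp := hqp) (hI := hI) (hr := hr) (hs := hs) (hv := hv)

/-- **FED twin of `JET.bsdp_of_carrierNeCertificate_level_of_mult`** — bucket A, `p` multiplicative, level form
(pv-1, p462126): the consumer's statement with `hrec` / `hD36` SUPPLIED by the Literature theorems and
`hlev` by `hmod : exists_isNewformOf`; every other binder verbatim, by name. -/
theorem bsdp_of_carrierNeCertificate_level_of_mult_fed
    (hJ : JetchevDivisibilityCarrierNe)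
    (hMcU : McCallum1991_padicValNat_card_sha_primary_add_le_of_globalDivisibility)
    (hGZK : rank_eq_analyticRank_of_analyticRank_le_one)
    (hKo : ∀ (N : ℕ) [NeZero N] (W : WeierstrassCurve ℚ) (K : Type) [Field K] [NumberField K],
      kolyvagin N W K)
    (hmod : exists_isNewformOf) (W : WeierstrassCurve ℚ) [W.IsElliptic] [W.IsGloballyMinimal]
    (p : ℕ) [Fact p.Prime] {N : ℕ} [NeZero N] {K : Type} [Field K] [NumberField K]
    (hK : IsImaginaryQuadratic K) (hD3 : NumberField.discr K ≠ -3) (hD4 : NumberField.discr K ≠ -4)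
    (hH : SatisfiesHeegnerHypothesis N K) {P : (W.baseChange K).toAffine.Point}
    (hP : IsHeegnerPoint N W K P) (hnt : ¬ IsOfFinAddOrder P) (hp2 : p ≠ 2)
    (hmult : W.HasMultiplicativeReductionAtPrime p) (hsurj : W.HasSurjectiveModNGaloisRep p) (q : ℕ)
    [Fact q.Prime] (hqN : q ∣ N) (hqp : q ≠ p)
    (hI : padicValNat p (AddSubgroup.zmultiples P).index ≤
      padicValNat p ((W.baseChange ℚ_[q]).localTamagawaNumber ℤ_[q]))
    (hr : W.analyticRank ≤ 1) {s : ℚ} (hs : shaAn W = (s : ℂ)) (hv : padicValRat p s = 0) :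
    BSDp W p :=
  bsdp_of_carrierNeCertificate_level_of_mult
    (hJ := hJ) (hMcU := hMcU) (hGZK := hGZK) (hKo := hKo)
    (hrec := heegnerPointOfConductor_one_galoisConj_forall)
    (hD36 := (fun N _ W K _ _ => phi_heegnerTau_mem_singularModuliField_holds N W K))
    (hlev := (level_eq_conductorNorm_forall_of_exists_isNewformOf hmod)) (W := W) (p := p)
    (hK := hK) (hD3 := hD3) (hD4 := hD4) (hH := hH) (hP := hP) (hnt := hnt) (hp2 := hp2)
    (hmult := hmult) (hsurj := hsurj) (q := q) (hqN := hqN) (hqp := hqp) (hI := hI) (hr := hr)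
    (hs := hs) (hv := hv)

/-- **FED twin of `JET.bsdp_of_carrierNeCertificate_level_of_irr_of_ram`** — bucket A, `p = 3`, road R
(irreducible + a (ram) prime; pv-1): the consumer's statement with `hrec` / `hD36` SUPPLIED by the
Literature theorems and `hlev` by `hmod : exists_isNewformOf`; every other binder verbatim, by name. -/
theorem bsdp_of_carrierNeCertificate_level_of_irr_of_ram_fed
    (hJ : JetchevDivisibilityCarrierNe)
    (hMcU : McCallum1991_padicValNat_card_sha_primary_add_le_of_globalDivisibility)
    (hGZK : rank_eq_analyticRank_of_analyticRank_le_one)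
    (hKo : ∀ (N : ℕ) [NeZero N] (W : WeierstrassCurve ℚ) (K : Type) [Field K] [NumberField K],
      kolyvagin N W K)
    (hmod : exists_isNewformOf) (W : WeierstrassCurve ℚ) [W.IsElliptic] [W.IsGloballyMinimal]
    (p : ℕ) [Fact p.Prime] {N : ℕ} [NeZero N] {K : Type} [Field K] [NumberField K]
    (hK : IsImaginaryQuadratic K) (hD3 : NumberField.discr K ≠ -3) (hD4 : NumberField.discr K ≠ -4)
    (hH : SatisfiesHeegnerHypothesis N K) {P : (W.baseChange K).toAffine.Point}
    (hP : IsHeegnerPoint N W K P) (hnt : ¬ IsOfFinAddOrder P) (hp2 : p ≠ 2)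
    (hirr : W.HasIrreducibleModPGaloisRep p) (hram : Ram W p) (q : ℕ) [Fact q.Prime] (hqN : q ∣ N)
    (hqp : q ≠ p)
    (hI : padicValNat p (AddSubgroup.zmultiples P).index ≤
      padicValNat p ((W.baseChange ℚ_[q]).localTamagawaNumber ℤ_[q]))
    (hr : W.analyticRank ≤ 1) {s : ℚ} (hs : shaAn W = (s : ℂ)) (hv : padicValRat p s = 0) :
    BSDp W p :=
  bsdp_of_carrierNeCertificate_level_of_irr_of_ram
    (hJ := hJ) (hMcU := hMcU) (hGZK := hGZK) (hKo := hKo)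
    (hrec := heegnerPointOfConductor_one_galoisConj_forall)
    (hD36 := (fun N _ W K _ _ => phi_heegnerTau_mem_singularModuliField_holds N W K))
    (hlev := (level_eq_conductorNorm_forall_of_exists_isNewformOf hmod)) (W := W) (p := p)
    (hK := hK) (hD3 := hD3) (hD4 := hD4) (hH := hH) (hP := hP) (hnt := hnt) (hp2 := hp2)
    (hirr := hirr) (hram := hram) (q := q) (hqN := hqN) (hqp := hqp) (hI := hI) (hr := hr)
    (hs := hs) (hv := hv)

/-- **FED twin of `JET.bsdp_of_carrierNeCertificate_level_three_of_frobenius`** — bucket A, `p = 3`, road F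
(three Frobenius witnesses; pv-1): the consumer's statement with `hrec` / `hD36` SUPPLIED by the Literature
theorems and `hlev` by `hmod : exists_isNewformOf`; every other binder verbatim, by name. -/
theorem bsdp_of_carrierNeCertificate_level_three_of_frobenius_fed
    (hJ : JetchevDivisibilityCarrierNe)
    (hMcU : McCallum1991_padicValNat_card_sha_primary_add_le_of_globalDivisibility)
    (hGZK : rank_eq_analyticRank_of_analyticRank_le_one)
    (hKo : ∀ (N : ℕ) [NeZero N] (W : WeierstrassCurve ℚ) (K : Type) [Field K] [NumberField K],
      kolyvagin N W K)
    (hmod : exists_isNewformOf) (W : WeierstrassCurve ℚ) [W.IsElliptic] [W.IsGloballyMinimal]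
    {N : ℕ} [NeZero N] {K : Type} [Field K] [NumberField K] (hK : IsImaginaryQuadratic K)
    (hD3 : NumberField.discr K ≠ -3) (hD4 : NumberField.discr K ≠ -4)
    (hH : SatisfiesHeegnerHypothesis N K) {P : (W.baseChange K).toAffine.Point}
    (hP : IsHeegnerPoint N W K P) (hnt : ¬ IsOfFinAddOrder P)
    (hsurj : W.HasSurjectiveModNGaloisRep 3) (ℓ : ℕ) [Fact ℓ.Prime]
    (hgood : W.HasGoodReductionAtPrime ℓ) (hℓ9 : ℓ % 9 = 2 ∨ ℓ % 9 = 5)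
    (ha9 : W.frobeniusTrace ℓ % 9 = 3 ∨ W.frobeniusTrace ℓ % 9 = 6) (q : ℕ) [Fact q.Prime]
    (hqN : q ∣ N) (hq3 : q ≠ 3)
    (hI : padicValNat 3 (AddSubgroup.zmultiples P).index ≤
      padicValNat 3 ((W.baseChange ℚ_[q]).localTamagawaNumber ℤ_[q]))
    (hr : W.analyticRank ≤ 1) {s : ℚ} (hs : shaAn W = (s : ℂ)) (hv : padicValRat 3 s = 0) :
    BSDp W 3 :=
  bsdp_of_carrierNeCertificate_level_three_of_frobenius
    (hJ := hJ) (hMcU := hMcU) (hGZK := hGZK) (hKo := hKo)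
    (hrec := heegnerPointOfConductor_one_galoisConj_forall)
    (hD36 := (fun N _ W K _ _ => phi_heegnerTau_mem_singularModuliField_holds N W K))
    (hlev := (level_eq_conductorNorm_forall_of_exists_isNewformOf hmod)) (W := W) (hK := hK)
    (hD3 := hD3) (hD4 := hD4) (hH := hH) (hP := hP) (hnt := hnt) (hsurj := hsurj) (ℓ := ℓ)
    (hgood := hgood) (hℓ9 := hℓ9) (ha9 := ha9) (q := q) (hqN := hqN) (hq3 := hq3) (hI := hI)
    (hr := hr) (hs := hs) (hv := hv)

/-! ## §2 bucket B (carrier `q = p`, multiplicative or additive at `p`) -/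
/-- **FED twin of `JET.bsdp_of_carrierMultCertificate_level_of_surj`** — bucket B, level form — the road
consumer of OFFER-JET-DOCSTRIKE-BUCKET-B (pv-2, p464096): the consumer's statement with `hrec` / `hD36`
SUPPLIED by the Literature theorems and `hlev` by `hmod : exists_isNewformOf`; every other binder verbatim,
by name. -/
theorem bsdp_of_carrierMultCertificate_level_of_surj_fed
    (hJ : JetchevDivisibilityCarrierMult)
    (hMcU : McCallum1991_padicValNat_card_sha_primary_add_le_of_globalDivisibility)
    (hGZK : rank_eq_analyticRank_of_analyticRank_le_one)
    (hKo : ∀ (N : ℕ) [NeZero N] (W : WeierstrassCurve ℚ) (K : Type) [Field K] [NumberField K],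
      kolyvagin N W K)
    (hmod : exists_isNewformOf) (W : WeierstrassCurve ℚ) [W.IsElliptic] [W.IsGloballyMinimal]
    (p : ℕ) [Fact p.Prime] {N : ℕ} [NeZero N] {K : Type} [Field K] [NumberField K]
    (hK : IsImaginaryQuadratic K) (hD3 : NumberField.discr K ≠ -3) (hD4 : NumberField.discr K ≠ -4)
    (hH : SatisfiesHeegnerHypothesis N K) {P : (W.baseChange K).toAffine.Point}
    (hP : IsHeegnerPoint N W K P) (hnt : ¬ IsOfFinAddOrder P) (hp2 : p ≠ 2)
    (hmult : W.HasMultiplicativeReductionAtPrime p) (hsurj : W.HasSurjectiveModNGaloisRep p)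
    (hI : padicValNat p (AddSubgroup.zmultiples P).index ≤
      padicValNat p ((W.baseChange ℚ_[p]).localTamagawaNumber ℤ_[p]))
    (hr : W.analyticRank ≤ 1) {s : ℚ} (hs : shaAn W = (s : ℂ)) (hv : padicValRat p s = 0) :
    BSDp W p :=
  bsdp_of_carrierMultCertificate_level_of_surj
    (hJ := hJ) (hMcU := hMcU) (hGZK := hGZK) (hKo := hKo)
    (hrec := heegnerPointOfConductor_one_galoisConj_forall)
    (hD36 := (fun N _ W K _ _ => phi_heegnerTau_mem_singularModuliField_holds N W K))
    (hlev := (level_eq_conductorNorm_forall_of_exists_isNewformOf hmod)) (W := W) (p := p)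
    (hK := hK) (hD3 := hD3) (hD4 := hD4) (hH := hH) (hP := hP) (hnt := hnt) (hp2 := hp2)
    (hmult := hmult) (hsurj := hsurj) (hI := hI) (hr := hr) (hs := hs) (hv := hv)

/-- **FED twin of `JET.bsdp_of_carrierAddCertificate_level`** — bucket B additive at `p`, level form (pv-2): the
consumer's statement with `hrec` / `hD36` SUPPLIED by the Literature theorems and `hlev` by `hmod :
exists_isNewformOf`; every other binder verbatim, by name. -/
theorem bsdp_of_carrierAddCertificate_level_fed
    (hJ : JetchevDivisibilityCarrierAdd)
    (hMcU : McCallum1991_padicValNat_card_sha_primary_add_le_of_globalDivisibility)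
    (hGZK : rank_eq_analyticRank_of_analyticRank_le_one)
    (hKo : ∀ (N : ℕ) [NeZero N] (W : WeierstrassCurve ℚ) (K : Type) [Field K] [NumberField K],
      kolyvagin N W K)
    (hmod : exists_isNewformOf) (W : WeierstrassCurve ℚ) [W.IsElliptic] [W.IsGloballyMinimal]
    (p : ℕ) [Fact p.Prime] {N : ℕ} [NeZero N] {K : Type} [Field K] [NumberField K]
    (hK : IsImaginaryQuadratic K) (hD3 : NumberField.discr K ≠ -3) (hD4 : NumberField.discr K ≠ -4)
    (hH : SatisfiesHeegnerHypothesis N K) {P : (W.baseChange K).toAffine.Point}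
    (hP : IsHeegnerPoint N W K P) (hnt : ¬ IsOfFinAddOrder P) (hp2 : p ≠ 2)
    (hng : ¬ W.HasGoodReductionAtPrime p) (hnm : ¬ W.HasMultiplicativeReductionAtPrime p)
    (htower : ∀ n : ℕ, W.HasSurjectiveModNGaloisRep (p ^ n : ℕ))
    (hI : padicValNat p (AddSubgroup.zmultiples P).index ≤
      padicValNat p ((W.baseChange ℚ_[p]).localTamagawaNumber ℤ_[p]))
    (hr : W.analyticRank ≤ 1) {s : ℚ} (hs : shaAn W = (s : ℂ)) (hv : padicValRat p s = 0) :
    BSDp W p :=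
  bsdp_of_carrierAddCertificate_level
    (hJ := hJ) (hMcU := hMcU) (hGZK := hGZK) (hKo := hKo)
    (hrec := heegnerPointOfConductor_one_galoisConj_forall)
    (hD36 := (fun N _ W K _ _ => phi_heegnerTau_mem_singularModuliField_holds N W K))
    (hlev := (level_eq_conductorNorm_forall_of_exists_isNewformOf hmod)) (W := W) (p := p)
    (hK := hK) (hD3 := hD3) (hD4 := hD4) (hH := hH) (hP := hP) (hnt := hnt) (hp2 := hp2)
    (hng := hng) (hnm := hnm) (htower := htower) (hI := hI) (hr := hr) (hs := hs) (hv := hv)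

/-- **FED twin of `JET.bsdp_of_carrierAddCertificate_level_three_of_frobenius`** — bucket B additive at `3`,
mod-`9` Frobenius tower (pv-2) — road A of the B witness tables: the consumer's statement with `hrec` /
`hD36` SUPPLIED by the Literature theorems and `hlev` by `hmod : exists_isNewformOf`; every other binder
verbatim, by name. -/
theorem bsdp_of_carrierAddCertificate_level_three_of_frobenius_fed
    (hJ : JetchevDivisibilityCarrierAdd)
    (hMcU : McCallum1991_padicValNat_card_sha_primary_add_le_of_globalDivisibility)
    (hGZK : rank_eq_analyticRank_of_analyticRank_le_one)
    (hKo : ∀ (N : ℕ) [NeZero N] (W : WeierstrassCurve ℚ) (K : Type) [Field K] [NumberField K],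
      kolyvagin N W K)
    (hmod : exists_isNewformOf) (W : WeierstrassCurve ℚ) [W.IsElliptic] [W.IsGloballyMinimal]
    {N : ℕ} [NeZero N] {K : Type} [Field K] [NumberField K] (hK : IsImaginaryQuadratic K)
    (hD3 : NumberField.discr K ≠ -3) (hD4 : NumberField.discr K ≠ -4)
    (hH : SatisfiesHeegnerHypothesis N K) {P : (W.baseChange K).toAffine.Point}
    (hP : IsHeegnerPoint N W K P) (hnt : ¬ IsOfFinAddOrder P) (hng : ¬ W.HasGoodReductionAtPrime 3)
    (hnm : ¬ W.HasMultiplicativeReductionAtPrime 3) (hsurj : W.HasSurjectiveModNGaloisRep 3) (ℓ : ℕ)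
    [Fact ℓ.Prime] (hgood : W.HasGoodReductionAtPrime ℓ) (hℓ9 : ℓ % 9 = 2 ∨ ℓ % 9 = 5)
    (ha9 : W.frobeniusTrace ℓ % 9 = 3 ∨ W.frobeniusTrace ℓ % 9 = 6)
    (hI : padicValNat 3 (AddSubgroup.zmultiples P).index ≤
      padicValNat 3 ((W.baseChange ℚ_[3]).localTamagawaNumber ℤ_[3]))
    (hr : W.analyticRank ≤ 1) {s : ℚ} (hs : shaAn W = (s : ℂ)) (hv : padicValRat 3 s = 0) :
    BSDp W 3 :=
  bsdp_of_carrierAddCertificate_level_three_of_frobenius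
    (hJ := hJ) (hMcU := hMcU) (hGZK := hGZK) (hKo := hKo)
    (hrec := heegnerPointOfConductor_one_galoisConj_forall)
    (hD36 := (fun N _ W K _ _ => phi_heegnerTau_mem_singularModuliField_holds N W K))
    (hlev := (level_eq_conductorNorm_forall_of_exists_isNewformOf hmod)) (W := W) (hK := hK)
    (hD3 := hD3) (hD4 := hD4) (hH := hH) (hP := hP) (hnt := hnt) (hng := hng) (hnm := hnm)
    (hsurj := hsurj) (ℓ := ℓ) (hgood := hgood) (hℓ9 := hℓ9) (ha9 := ha9) (hI := hI) (hr := hr)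
    (hs := hs) (hv := hv)

end Summit.BirchSwinnertonDyer.Rank1Residual.JET
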